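import Summits.CriticalPhenomena.PercolationContinuityZ3.Theorems.Transplant.SkelFrmBParamsFaceCountsYA
import Summits.CriticalPhenomena.PercolationContinuityZ3.Theorems.Transplant.SkelFrmBParamsFaceCountsW
import HarnessLib

/-!
# N2 (frames-only node, OPEN) — (F) column under (R-44)(c): **THE ONE-SIDED TANGENTIAL COUNT OF THE y′-FACE ROUTE** (`σT := 1`, window landing)

J23/(R-44)(c): the T numbers (`KS.σTY := if FcA ≤ T0Y then 1 else −1`, `KS.N3Y` — aim at the target CENTRE with either sign, CountsYA `N3Y_spec`) are
replaced on the served side by the FORWARD-ONLY count **`KS.N3WY bw := Skelφ.fwdCount T0Y (FcA yL + u₀) u₀ bw`** (the tangential run has `N₃ + 1`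
strides, so the count starts after the forced first stride) aiming at the WINDOW `T1X ± bw` (`bw := b⊥ − W` of record): from a forward-bounded origin
`FcA yL + u₀ ≤ T0Y + bw` (the contact's room `hF⊥ = c⊥ + ρ⊥` of `PCells2V` + p5-g16's feasibility row with one extra stride) the landing
`FcA yL + 1·u₀·(N3WY + 1)` lies in the window, and the stride budget has `N3Y_spec`'s shape — so the keystone's numbers `(σT, N₃) := (1, N3WY)` feed the
same FY/width/budget rows (`N3WY_spec`).  Cell-agnostic (`P : PCells2T`, instantiated at `(fcellsV …).toPCells2T`).
NON-VACUITY: hypotheses = `u₁ ≤ 2·bw` (stride shorter than the window), `FcA yL + u₀ ≤ T0Y + bw` (forward-bounded start) — the value rows of record at small2.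
builds on p205010 (kernel theorem, internal audit signed; external expert review pending) — nothing here uses p205010; NOTHING is claimed about the open node
`SamePDropOfSkeletonFrm₁`.
Lane `prim-bschramm`, seat `prim-hp-8` (gen 42); helper file (`--supports stmt-CriticalPhenomena-4575 --as helper`).
* `KS.N3WY`, **`KS.N3WY_spec`** (`σ = 1`; budget `u₀·(N3WY+1) ≤ |T0Y − FcA| + 2u₀`; window landing `T0Y − bw ≤ FcA + u₀·(N3WY+1) ≤ T0Y + bw`).
[cite: KozmaNitzan2024, §4 Lemma 11 (p. 22), Lemma 12 (pp. 23–25)] [cite: MartineauTassion2017, §4.1]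
-/

noncomputable section

open scoped Classical

namespace Summit.CriticalPhenomena.PercolationContinuityZ3.Theorems.Transplant

namespace PlanarSkeletonFrm

namespace NegB

open Literature.Probability.Percolation Literature.Probability.LatticeModels SimpleGraph
open Literature.Probability.Percolation.KozmaNitzan.Cells (oth sgOf sgOf_sign)
open SkelConc (Consts)
open Skelφ.StepI (DataNS)
open Neg

namespace KS

variable (κ : Consts) {V : Type} [DecidableEq V] [Countable V] {G : SimpleGraph V} [G.LocallyFinite] (Φ : PlanarSkeletonFrm G) (t : V)
  (p : unitInterval) (D : DataNS V) (g f : ℕ)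

/-- **The one-sided tangential count of the y′-face route** (window half-width `bw`): forward x-strides after the forced first one. [this work] -/
def N3WY (P : PCells2T) (yL x : Site 2) (du : MDir) (z : Site 2) (bw : ℕ) : ℕ :=
  Skelφ.fwdCount (T0Y P x du z) (FcA κ Φ t p D g f yL + u₀A κ Φ t p D g f) (u₀A κ Φ t p D g f).toNat bw

/-- **The one-sided count's spec in `N3Y_spec`'s shape** (sign `1`): the stride budget `u₀·(N+1) ≤ |T0Y − FcA| + 2u₀` and the WINDOW landing
`T0Y − bw ≤ FcA + 1·u₀·(N+1) ≤ T0Y + bw`, from `u₀ ≤ 2bw` and the forward-bounded start `FcA + u₀ ≤ T0Y + bw`.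
[cite: KozmaNitzan2024, §4 Lemma 12 (pp. 23–25)] -/
theorem N3WY_spec (P : PCells2T) (yL x : Site 2) (du : MDir) (z : Site 2) {bw : ℕ} (hbw : u₀A κ Φ t p D g f ≤ 2 * (bw : ℤ))
    (hF : FcA κ Φ t p D g f yL + u₀A κ Φ t p D g f ≤ T0Y P x du z + bw) :
    u₀A κ Φ t p D g f * ((N3WY κ Φ t p D g f P yL x du z bw : ℤ) + 1) ≤ |T0Y P x du z - FcA κ Φ t p D g f yL| + 2 * u₀A κ Φ t p D g f ∧
      T0Y P x du z - bw ≤ FcA κ Φ t p D g f yL + 1 * u₀A κ Φ t p D g f * ((N3WY κ Φ t p D g f P yL x du z bw : ℤ) + 1) ∧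
      FcA κ Φ t p D g f yL + 1 * u₀A κ Φ t p D g f * ((N3WY κ Φ t p D g f P yL x du z bw : ℤ) + 1) ≤ T0Y P x du z + bw := by
  have hu : 1 ≤ u₀A κ Φ t p D g f := (units_eqA κ Φ t p D g f).2.2.2.2.1
  set u := u₀A κ Φ t p D g f with hu_def
  set T := T0Y P x du z
  set F := FcA κ Φ t p D g f yL
  have hun : ((u.toNat : ℕ) : ℤ) = u := Int.toNat_of_nonneg (by linarith)
  have hu0 : 0 < u.toNat := by omega
  have key := Skelφ.fwdCount_spec (T := T) (F := F + u) (bw := bw) hu0 (by rw [hun]; exact hbw) hF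
  have up := Skelφ.mul_fwdCount_lt (T := T) (F := F + u) (bw := bw) hu0
  rw [hun] at key up
  have hN : (N3WY κ Φ t p D g f P yL x du z bw : ℤ) = (Skelφ.fwdCount T (F + u) u.toNat bw : ℤ) := rfl
  rw [hN]
  set N : ℤ := (Skelφ.fwdCount T (F + u) u.toNat bw : ℤ)
  have hN0 : 0 ≤ N := by positivity
  refine ⟨?_, by linarith [key.1], by linarith [key.2]⟩
  -- budget: either no stride beyond the forced one, or the strides stop before the near edge plus one stride
  rcases le_max_iff.1 up with h | h
  · have : u * N ≤ 0 := by linarith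
    have hN' : N = 0 := le_antisymm (by nlinarith) hN0
    rw [hN']; linarith [abs_nonneg (T - F)]
  · have hTF : T - F ≤ |T - F| := le_abs_self _
    nlinarith

end KS

end NegB

end PlanarSkeletonFrm

end Summit.CriticalPhenomena.PercolationContinuityZ3.Theorems.Transplant

end
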